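import Summits.AtomisticToContinuum.FouriersLaw.Theses.StaticAbelianSqueeze

/-!
# Birth skeleton (BC3) — crux `StaticAbelianSqueeze.ResolventSqueeze` (stmt-AtomisticToContinuum-13417)

Route `route-AtomisticToContinuum-StaticAbelianSqueeze`, sub-problem `FouriersLaw`, crux rank 3, "(S)":
for `P = pinnedChain ω₂ lam β γ` (all `> 0`), `T > 0`, every shift-invariant DLR Gibbs state `μ_T`, every
`ν > 0`, all local test functions `g, u` and every `ε > 0`, eventually in `N`,
`(N−1)(PRIMAL_ν(g) − ε) ≤ F_N(ν) ≤ (N−1)(DUAL_ν(u) + ε)`, where (finite chain, both baths at `T`)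
`J = Σ_i j_i`, `μ_N = P.gibbsMeasure N T`, `P_t = P.transitionKernel N T T t`,
`F_N(ν) = ∫₀^∞ e^{−νt} ∫ J · (P_t J) dμ_N dt`, and (infinite chain, statics only)
`⟨⟨f₁,f₂⟩⟩ = Σ_x Cov_{μ_T}(f₁, f₂∘τ_x)`, `j = bondCurrentZ · 0`, `𝒜 = liouvilleZ P`,
`PRIMAL_ν(g) = 2⟨⟨j,g⟩⟩ − ν⟨⟨g,g⟩⟩ − ν⁻¹⟨⟨𝒜g,𝒜g⟩⟩`, `DUAL_ν(u) = ν⁻¹⟨⟨j+𝒜u, j+𝒜u⟩⟩ + ν⟨⟨u,u⟩⟩`.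

## Line `birth` — FIXED-`N` WEAK DUALITY × STATIC GLUING (the route's own foreseen layer-2 split of (S))

Finite-`N` notation (everything is INLINED in the statements, `let`-free so that the registered stub
signatures are the full propositions): `X_H h = Σ_i (p_i ∂_{q_i}h − ∂_{q_i}H ∂_{p_i}h)`
(the Hamiltonian part of `OscillatorChain.generator`; token-identical with the Theorems-side
`SuperadditiveResistance.DeviceLiouville.liouvilleOp`), the bath Dirichlet form at equal temperatures
`𝒟(h) = γ T Σ_i (1_{i=0} + 1_{i=N−1}) ∫ (∂_{p_i} h)² dμ_N` (`= −⟨h, γ S_B h⟩_{μ_N}`), the PRIMAL functional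
`Φ_N(h) = 2⟨J,h⟩_{μ_N} − ν‖h‖²_{μ_N} − 𝒟(h) − ν⁻¹‖X_H h‖²_{μ_N}` and the DUAL functional
`Ψ_N(w) = ν⁻¹‖J + X_H w‖²_{μ_N} + ν‖w‖²_{μ_N} + 𝒟(w)`, over smooth compactly supported `h, w`.

* `stub_fixedNPrimal` (size M; provable with tree tools): `Φ_N(h) ≤ F_N(ν)` for every `h ∈ C_c^∞`.
  `F_N(ν) = ⟨J, u⟩_{μ_N}`, `u = (ν − L̄)⁻¹J`, for the `L²(μ_N)` semigroup of the CONSTRUCTED kernels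
  (Gibbs-invariant at `T_L = T_R = T`: tree `pinnedChain_gibbsMeasure_bind_transitionKernel`), `L̄` the closure
  of `L = X_H + γ S_B` on `C_c^∞` (essential m-dissipativity = range density, tree
  `SubdiffusiveBondHeat.stub_resolventRangeDense`); then `‖u‖²_{ν−γS} = ⟨J,u⟩`,
  `2⟨J,h⟩ = 2⟨u, (ν − γS_B + X_H)h⟩ ≤ ‖u‖²_{ν−γS} + ‖(ν−γS_B)h + X_H h‖²_{(ν−γS)⁻¹}` and the cross term
  `⟨h, X_H h⟩` vanishes (Liouville), `(ν − γS_B)⁻¹ ≤ ν⁻¹`. The lower (sup) half of the variational formula for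
  non-reversible resolvents (KomorowskiLandimOlla2012 Ch. 2; Sethuraman–Varadhan–Yau 2000; BernardinOlla2011 §6).
* `stub_fixedNDual` (size M): `F_N(ν) ≤ Ψ_N(w)` for every `w ∈ C_c^∞` — the upper (inf) half:
  `J + X_H w = (ν − γS_B)u − X_H(u − w)`, so `‖J + X_H w‖²_{(ν−γS)⁻¹} + ‖w‖²_{ν−γS} − ‖u‖²_{ν−γS}
  = 2⟨X_H(w − u), w⟩ + ‖X_H(u − w)‖²_{−1} + ‖w‖²₁ ≥ 0`, with `u` approximated in graph norm from `C_c^∞`.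
* `stub_primalGluing` (size L; STATICS ONLY — no kernel, no semigroup): eventually in `N` there is
  `h ∈ C_c^∞(PhaseSpace N)` with `Φ_N(h) ≥ (N−1)(PRIMAL_ν(g) − ε)`: the mollified, cut-off, `μ_N`-centred sum of
  the INTERIOR translates of `g` (windows off the two thermostatted sites, so `𝒟 = 0` and `X_H` acts as `𝒜`);
  `E_{μ_N} X_H f = 0`; the four bilinear terms are double sums of covariances of local observables under the
  free-end canonical measure `μ_N`, equal per unit length to the translation-summed `μ_T`-covariances up to
  `o(N)` by equivalence of the 1-D ensembles away from the ends and summable decay of correlations UNIFORM in `N`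
  (transfer operator; tree: `InfiniteChainShiftInvariantUniqueness`, `ChainMixingClustering`,
  `EmbeddedDrudeMourreAbelThermodynamicLimitCentralWindowEnsembleEquivalence`, `…AnchoredKuboUniformMixing`);
  boundary windows cost `O(R)` against `O(N)` (LandimOllaVaradhan2002 / Jara2006 gluing; ArmstrongKuusiMourrat2019 `ν/ν*`).
* `stub_dualGluing` (size L; statics only): eventually in `N` there is `w ∈ C_c^∞` with
  `Ψ_N(w) ≤ (N−1)(DUAL_ν(u) + ε)` — same gluing for `u`, plus `‖J‖²_{μ_N} = (N−1)⟨⟨j,j⟩⟩ + O(1)` over ALL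
  bonds (the boundary-layer covariances are summable).
* COMPOSITION `ResolventSqueeze_of` (sorry-free): thresholds `max N₁ N₂`;
  `(N−1)(PRIMAL − ε) ≤ Φ_N(h_N) ≤ F_N(ν) ≤ Ψ_N(w_N) ≤ (N−1)(DUAL + ε)`.

Hardest stub: `stub_primalGluing` / `stub_dualGluing` (N-uniform mixing of the free-end anharmonic Gibbs chain
for polynomially unbounded local observables + two boundary layers); the fixed-`N` pair is infrastructure the
tree largely has. Why the cut is not a costume: stubs 1–2 never mention `μ_T`, the brackets or local test
functions (they bound `F_N(ν)` by finite-`N` functionals of ARBITRARY test functions and hold at every `N`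
separately), stubs 3–4 never mention the kernels, the semigroup or `F_N` (pure equilibrium statistical
mechanics); neither pair alone orders `F_N` against `PRIMAL/DUAL`. All four are false/meaningless rewordings of
nothing in the negatives index (no FouriersLaw entry bears on equilibrium statics or fixed-`N` resolvent forms).
Disproof used: none on file for this crux (no `Cruxes/ResolventSqueeze/` workfiles at registration).

File map: §1 `Sig.stub_<name> : Prop` (the four stub STATEMENTS, named so that the composition's hypotheses
are the declared stubs BY NAME); §2 `theorem stub_<name> : <statement verbatim> := by sorry` (the registered
stubs — the ONLY sorries); §3 `ResolventSqueeze_of` (the composition, the unique declaration concluding the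
crux); §4 an `example` instantiating it through the sorried stubs.
-/

noncomputable section

namespace Summit.AtomisticToContinuum.FouriersLaw.Cruxes.ResolventSqueeze.Birth

open MeasureTheory Filter Set Topology
open scoped BigOperators
open Literature.MathematicalPhysics.KineticTheory.HeatConduction
open Summit.AtomisticToContinuum.FouriersLaw.Theses.StaticAbelianSqueeze (ResolventSqueeze)

/-! ## §1 The stub statements (named) -/

/-- Statement of `stub_fixedNPrimal`: for all parameters `> 0`, `T > 0`, `ν > 0`, `N` and every smooth
compactly supported `h` on `PhaseSpace N`, `Φ_N(h) ≤ F_N(ν)`. -/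
def Sig.stub_fixedNPrimal : Prop :=
  ∀ ω₂ lam β γ : ℝ, 0 < ω₂ → 0 < lam → 0 < β → 0 < γ → ∀ T : ℝ, 0 < T → ∀ ν : ℝ, 0 < ν → ∀ N : ℕ,
    ∀ h : PhaseSpace N → ℝ, ContDiff ℝ ((⊤ : ℕ∞) : WithTop ℕ∞) h → HasCompactSupport h →
      2 * (∫ z, (∑ i : Fin N, (pinnedChain ω₂ lam β γ).bondCurrent N i z) * h z ∂((pinnedChain ω₂ lam β γ).gibbsMeasure N T))
          - ν * (∫ z, h z ^ 2 ∂((pinnedChain ω₂ lam β γ).gibbsMeasure N T))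
          - γ * T * (∑ i : Fin N, ((if i.val = 0 then ∫ z, partialP i h z ^ 2 ∂((pinnedChain ω₂ lam β γ).gibbsMeasure N T) else 0)
            + (if i.val = N - 1 then ∫ z, partialP i h z ^ 2 ∂((pinnedChain ω₂ lam β γ).gibbsMeasure N T) else 0)))
          - ν⁻¹ * (∫ z, (∑ i : Fin N, (z.2 i * partialQ i h z - partialQ i ((pinnedChain ω₂ lam β γ).hamiltonian N) z * partialP i h z)) ^ 2 ∂((pinnedChain ω₂ lam β γ).gibbsMeasure N T))
        ≤ (∫ t in Set.Ioi (0:ℝ), Real.exp (-(ν * t)) * ∫ z, (∑ i : Fin N, (pinnedChain ω₂ lam β γ).bondCurrent N i z) * (∫ y, (∑ i : Fin N, (pinnedChain ω₂ lam β γ).bondCurrent N i y) ∂((pinnedChain ω₂ lam β γ).transitionKernel N T T t.toNNReal z)) ∂((pinnedChain ω₂ lam β γ).gibbsMeasure N T))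


/-- Statement of `stub_fixedNDual`: for all parameters `> 0`, `T > 0`, `ν > 0`, `N` and every smooth compactly
supported `w` on `PhaseSpace N`, `F_N(ν) ≤ Ψ_N(w)`. -/
def Sig.stub_fixedNDual : Prop :=
  ∀ ω₂ lam β γ : ℝ, 0 < ω₂ → 0 < lam → 0 < β → 0 < γ → ∀ T : ℝ, 0 < T → ∀ ν : ℝ, 0 < ν → ∀ N : ℕ,
    ∀ w : PhaseSpace N → ℝ, ContDiff ℝ ((⊤ : ℕ∞) : WithTop ℕ∞) w → HasCompactSupport w →
      (∫ t in Set.Ioi (0:ℝ), Real.exp (-(ν * t)) * ∫ z, (∑ i : Fin N, (pinnedChain ω₂ lam β γ).bondCurrent N i z) * (∫ y, (∑ i : Fin N, (pinnedChain ω₂ lam β γ).bondCurrent N i y) ∂((pinnedChain ω₂ lam β γ).transitionKernel N T T t.toNNReal z)) ∂((pinnedChain ω₂ lam β γ).gibbsMeasure N T))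
        ≤ ν⁻¹ * (∫ z, ((∑ i : Fin N, (pinnedChain ω₂ lam β γ).bondCurrent N i z) + (∑ i : Fin N, (z.2 i * partialQ i w z - partialQ i ((pinnedChain ω₂ lam β γ).hamiltonian N) z * partialP i w z))) ^ 2 ∂((pinnedChain ω₂ lam β γ).gibbsMeasure N T))
          + ν * (∫ z, w z ^ 2 ∂((pinnedChain ω₂ lam β γ).gibbsMeasure N T))
          + γ * T * (∑ i : Fin N, ((if i.val = 0 then ∫ z, partialP i w z ^ 2 ∂((pinnedChain ω₂ lam β γ).gibbsMeasure N T) else 0)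
            + (if i.val = N - 1 then ∫ z, partialP i w z ^ 2 ∂((pinnedChain ω₂ lam β γ).gibbsMeasure N T) else 0)))


/-- Statement of `stub_primalGluing`: for all parameters `> 0`, `T > 0`, every shift-invariant DLR Gibbs state
`μ_T`, every `ν > 0`, local `g` and `ε > 0`: eventually in `N` there is a smooth compactly supported `h` on
`PhaseSpace N` with `(N−1)(PRIMAL_ν(g) − ε) ≤ Φ_N(h)`. -/
def Sig.stub_primalGluing : Prop :=
  ∀ ω₂ lam β γ : ℝ, 0 < ω₂ → 0 < lam → 0 < β → 0 < γ → ∀ T : ℝ, 0 < T →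
    ∀ μT : MeasureTheory.Measure ChainConfig, (pinnedChain ω₂ lam β γ).IsChainGibbsMeasure T μT → IsShiftInvariant μT →
      ∀ ν : ℝ, 0 < ν → ∀ g : ChainConfig → ℝ, IsLocalTestFunction g → ∀ ε : ℝ, 0 < ε → ∃ N₀ : ℕ, ∀ N : ℕ, N₀ ≤ N →
        ∃ h : PhaseSpace N → ℝ, ContDiff ℝ ((⊤ : ℕ∞) : WithTop ℕ∞) h ∧ HasCompactSupport h ∧
          ((N:ℝ) - 1) * ((2 * (∑' x : ℤ, ((∫ σ, (pinnedChain ω₂ lam β γ).bondCurrentZ σ 0 * g (fun i => σ (i + x)) ∂μT) - (∫ σ, (pinnedChain ω₂ lam β γ).bondCurrentZ σ 0 ∂μT) * (∫ σ, g σ ∂μT)))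
            - ν * (∑' x : ℤ, ((∫ σ, g σ * g (fun i => σ (i + x)) ∂μT) - (∫ σ, g σ ∂μT) * (∫ σ, g σ ∂μT)))
            - ν⁻¹ * (∑' x : ℤ, ((∫ σ, liouvilleZ (pinnedChain ω₂ lam β γ) g σ * liouvilleZ (pinnedChain ω₂ lam β γ) g (fun i => σ (i + x)) ∂μT) - (∫ σ, liouvilleZ (pinnedChain ω₂ lam β γ) g σ ∂μT) * (∫ σ, liouvilleZ (pinnedChain ω₂ lam β γ) g σ ∂μT)))) - ε)
          ≤ 2 * (∫ z, (∑ i : Fin N, (pinnedChain ω₂ lam β γ).bondCurrent N i z) * h z ∂((pinnedChain ω₂ lam β γ).gibbsMeasure N T))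
          - ν * (∫ z, h z ^ 2 ∂((pinnedChain ω₂ lam β γ).gibbsMeasure N T))
          - γ * T * (∑ i : Fin N, ((if i.val = 0 then ∫ z, partialP i h z ^ 2 ∂((pinnedChain ω₂ lam β γ).gibbsMeasure N T) else 0)
            + (if i.val = N - 1 then ∫ z, partialP i h z ^ 2 ∂((pinnedChain ω₂ lam β γ).gibbsMeasure N T) else 0)))
          - ν⁻¹ * (∫ z, (∑ i : Fin N, (z.2 i * partialQ i h z - partialQ i ((pinnedChain ω₂ lam β γ).hamiltonian N) z * partialP i h z)) ^ 2 ∂((pinnedChain ω₂ lam β γ).gibbsMeasure N T))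


/-- Statement of `stub_dualGluing`: for all parameters `> 0`, `T > 0`, every shift-invariant DLR Gibbs state
`μ_T`, every `ν > 0`, local `u` and `ε > 0`: eventually in `N` there is a smooth compactly supported `w` on
`PhaseSpace N` with `Ψ_N(w) ≤ (N−1)(DUAL_ν(u) + ε)`. -/
def Sig.stub_dualGluing : Prop :=
  ∀ ω₂ lam β γ : ℝ, 0 < ω₂ → 0 < lam → 0 < β → 0 < γ → ∀ T : ℝ, 0 < T →
    ∀ μT : MeasureTheory.Measure ChainConfig, (pinnedChain ω₂ lam β γ).IsChainGibbsMeasure T μT → IsShiftInvariant μT →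
      ∀ ν : ℝ, 0 < ν → ∀ u : ChainConfig → ℝ, IsLocalTestFunction u → ∀ ε : ℝ, 0 < ε → ∃ N₀ : ℕ, ∀ N : ℕ, N₀ ≤ N →
        ∃ w : PhaseSpace N → ℝ, ContDiff ℝ ((⊤ : ℕ∞) : WithTop ℕ∞) w ∧ HasCompactSupport w ∧
          ν⁻¹ * (∫ z, ((∑ i : Fin N, (pinnedChain ω₂ lam β γ).bondCurrent N i z) + (∑ i : Fin N, (z.2 i * partialQ i w z - partialQ i ((pinnedChain ω₂ lam β γ).hamiltonian N) z * partialP i w z))) ^ 2 ∂((pinnedChain ω₂ lam β γ).gibbsMeasure N T))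
          + ν * (∫ z, w z ^ 2 ∂((pinnedChain ω₂ lam β γ).gibbsMeasure N T))
          + γ * T * (∑ i : Fin N, ((if i.val = 0 then ∫ z, partialP i w z ^ 2 ∂((pinnedChain ω₂ lam β γ).gibbsMeasure N T) else 0)
            + (if i.val = N - 1 then ∫ z, partialP i w z ^ 2 ∂((pinnedChain ω₂ lam β γ).gibbsMeasure N T) else 0)))
          ≤ ((N:ℝ) - 1) * ((ν⁻¹ * (∑' x : ℤ, ((∫ σ, ((pinnedChain ω₂ lam β γ).bondCurrentZ σ 0 + liouvilleZ (pinnedChain ω₂ lam β γ) u σ) * ((pinnedChain ω₂ lam β γ).bondCurrentZ (fun i => σ (i + x)) 0 + liouvilleZ (pinnedChain ω₂ lam β γ) u (fun i => σ (i + x))) ∂μT) - (∫ σ, ((pinnedChain ω₂ lam β γ).bondCurrentZ σ 0 + liouvilleZ (pinnedChain ω₂ lam β γ) u σ) ∂μT) * (∫ σ, ((pinnedChain ω₂ lam β γ).bondCurrentZ σ 0 + liouvilleZ (pinnedChain ω₂ lam β γ) u σ) ∂μT)))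
            + ν * (∑' x : ℤ, ((∫ σ, u σ * u (fun i => σ (i + x)) ∂μT) - (∫ σ, u σ ∂μT) * (∫ σ, u σ ∂μT)))) + ε)


/-! ## §2 The registered stubs (the only `sorry`s of the file) -/

/-- STUB 1 `stub_fixedNPrimal` — FIXED-`N` WEAK DUALITY, PRIMAL (lower) half (size M). For
`P = pinnedChain ω₂ lam β γ` (all `> 0`), `T > 0`, `ν > 0`, every `N` and every `h ∈ C_c^∞(PhaseSpace N)`:
`2⟨J,h⟩_{μ_N} − ν‖h‖²_{μ_N} − γTΣ_{bath}‖∂_p h‖²_{μ_N} − ν⁻¹‖X_H h‖²_{μ_N} ≤ F_N(ν) = ∫₀^∞ e^{−νt}⟨J, P_t J⟩_{μ_N} dt`.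
The sup half of the variational formula for the resolvent quadratic form of the non-reversible generator
`L = X_H + γ S_B` in `L²(μ_N)` (`(ν − γS_B)⁻¹ ≤ ν⁻¹`), for the `L²` semigroup of the constructed kernels.
Leans on (tree): `pinnedChain_gibbsMeasure_bind_transitionKernel` (Gibbs invariance of the kernels),
`SubdiffusiveBondHeat.stub_resolventRangeDense` (essential m-dissipativity on `C_c^∞`),
`integral_liouville_mul_gibbsDensity`, `integral_generator_mul_gibbsDensity` (adjoint calculus),
`pinnedChain_transitionKernel_apply` + CEHR Lyapunov moments (kernel integrability of `J`), route support items
GibbsKernelInvariant (stmt-13421) / GeneratorCore (stmt-13422). Why it might fail: only infrastructure — the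
identification `F_N(ν) = ⟨J,(ν − L̄)⁻¹J⟩` (measurability of `t ↦ ⟨J,P_tJ⟩`, moments of `P_t(z,·)`).
[KomorowskiLandimOlla2012 Ch. 2; BernardinOlla2011 §6; doi:10.1002/(SICI)1097-0312(200008)53:8<972::AID-CPA2>3.0.CO;2-# (Sethuraman–Varadhan–Yau 2000)] -/
theorem stub_fixedNPrimal :
  ∀ ω₂ lam β γ : ℝ, 0 < ω₂ → 0 < lam → 0 < β → 0 < γ → ∀ T : ℝ, 0 < T → ∀ ν : ℝ, 0 < ν → ∀ N : ℕ,
    ∀ h : PhaseSpace N → ℝ, ContDiff ℝ ((⊤ : ℕ∞) : WithTop ℕ∞) h → HasCompactSupport h →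
      2 * (∫ z, (∑ i : Fin N, (pinnedChain ω₂ lam β γ).bondCurrent N i z) * h z ∂((pinnedChain ω₂ lam β γ).gibbsMeasure N T))
          - ν * (∫ z, h z ^ 2 ∂((pinnedChain ω₂ lam β γ).gibbsMeasure N T))
          - γ * T * (∑ i : Fin N, ((if i.val = 0 then ∫ z, partialP i h z ^ 2 ∂((pinnedChain ω₂ lam β γ).gibbsMeasure N T) else 0)
            + (if i.val = N - 1 then ∫ z, partialP i h z ^ 2 ∂((pinnedChain ω₂ lam β γ).gibbsMeasure N T) else 0)))
          - ν⁻¹ * (∫ z, (∑ i : Fin N, (z.2 i * partialQ i h z - partialQ i ((pinnedChain ω₂ lam β γ).hamiltonian N) z * partialP i h z)) ^ 2 ∂((pinnedChain ω₂ lam β γ).gibbsMeasure N T))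
        ≤ (∫ t in Set.Ioi (0:ℝ), Real.exp (-(ν * t)) * ∫ z, (∑ i : Fin N, (pinnedChain ω₂ lam β γ).bondCurrent N i z) * (∫ y, (∑ i : Fin N, (pinnedChain ω₂ lam β γ).bondCurrent N i y) ∂((pinnedChain ω₂ lam β γ).transitionKernel N T T t.toNNReal z)) ∂((pinnedChain ω₂ lam β γ).gibbsMeasure N T)) := by
  sorry


/-- STUB 2 `stub_fixedNDual` — FIXED-`N` WEAK DUALITY, DUAL (upper) half (size M). For `P = pinnedChain ω₂ lam β γ`
(all `> 0`), `T > 0`, `ν > 0`, every `N` and every `w ∈ C_c^∞(PhaseSpace N)`: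
`F_N(ν) ≤ ν⁻¹‖J + X_H w‖²_{μ_N} + ν‖w‖²_{μ_N} + γTΣ_{bath}‖∂_p w‖²_{μ_N}`.
The inf half of the variational formula: with `u = (ν − L̄)⁻¹J`, `J + X_H w = (ν − γS_B)u − X_H(u − w)`, hence
`‖J + X_H w‖²_{(ν−γS_B)⁻¹} + ‖w‖²_{ν−γS_B} − ⟨J,u⟩ = 2⟨X_H(w−u), w⟩ + ‖X_H(u−w)‖²_{(ν−γS_B)⁻¹} + ‖w‖²_{ν−γS_B} ≥ 0`
(Cauchy–Schwarz in the `(ν − γS_B)^{±1}` pair of norms; `u` approximated from `C_c^∞` in graph norm), and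
`‖·‖²_{(ν−γS_B)⁻¹} ≤ ν⁻¹‖·‖²`. Same infrastructure as `stub_fixedNPrimal`. Why it might fail: only
infrastructure (as stub 1). [KomorowskiLandimOlla2012 Ch. 2; BernardinOlla2011 §6 eq. (var) and Prop. 4 (dual
witness `u = −V(r₁)/2` for the velocity-flip chain); LandimOllaVaradhan2002] -/
theorem stub_fixedNDual :
  ∀ ω₂ lam β γ : ℝ, 0 < ω₂ → 0 < lam → 0 < β → 0 < γ → ∀ T : ℝ, 0 < T → ∀ ν : ℝ, 0 < ν → ∀ N : ℕ,
    ∀ w : PhaseSpace N → ℝ, ContDiff ℝ ((⊤ : ℕ∞) : WithTop ℕ∞) w → HasCompactSupport w →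
      (∫ t in Set.Ioi (0:ℝ), Real.exp (-(ν * t)) * ∫ z, (∑ i : Fin N, (pinnedChain ω₂ lam β γ).bondCurrent N i z) * (∫ y, (∑ i : Fin N, (pinnedChain ω₂ lam β γ).bondCurrent N i y) ∂((pinnedChain ω₂ lam β γ).transitionKernel N T T t.toNNReal z)) ∂((pinnedChain ω₂ lam β γ).gibbsMeasure N T))
        ≤ ν⁻¹ * (∫ z, ((∑ i : Fin N, (pinnedChain ω₂ lam β γ).bondCurrent N i z) + (∑ i : Fin N, (z.2 i * partialQ i w z - partialQ i ((pinnedChain ω₂ lam β γ).hamiltonian N) z * partialP i w z))) ^ 2 ∂((pinnedChain ω₂ lam β γ).gibbsMeasure N T))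
          + ν * (∫ z, w z ^ 2 ∂((pinnedChain ω₂ lam β γ).gibbsMeasure N T))
          + γ * T * (∑ i : Fin N, ((if i.val = 0 then ∫ z, partialP i w z ^ 2 ∂((pinnedChain ω₂ lam β γ).gibbsMeasure N T) else 0)
            + (if i.val = N - 1 then ∫ z, partialP i w z ^ 2 ∂((pinnedChain ω₂ lam β γ).gibbsMeasure N T) else 0))) := by
  sorry


/-- STUB 3 `stub_primalGluing` — STATIC GLUING OF THE PRIMAL WITNESS (size L; LOAD-BEARING with stub 4; statics
only). For `P = pinnedChain ω₂ lam β γ` (all `> 0`), `T > 0`, every shift-invariant DLR Gibbs state `μ_T`, every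
`ν > 0`, every local test function `g` and `ε > 0`: eventually in `N` there is `h ∈ C_c^∞(PhaseSpace N)` with
`(N−1)(PRIMAL_ν(g) − ε) ≤ 2⟨J,h⟩_{μ_N} − ν‖h‖²_{μ_N} − γTΣ_{bath}‖∂_p h‖²_{μ_N} − ν⁻¹‖X_H h‖²_{μ_N}`.
Witness: mollification and smooth energy cut-off of the `μ_N`-centred sum of the INTERIOR translates
`g∘τ_x∘ι_N`, `R < x < N−1−R` (windows off the thermostatted sites `0, N−1`: the bath form vanishes and `X_H`
acts on them as `𝒜 = liouvilleZ`, by locality of the force); `E_{μ_N}[X_H f] = 0` (Liouville); the four terms are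
double sums of `μ_N`-covariances of local observables (`j_i`, `τ_x g`, `(𝒜g)∘τ_x`, polynomially bounded), equal to
`(N−1)` times the translation-summed `μ_T`-covariances up to `o(N)` by (i) equivalence of the free-end canonical
ensemble `μ_N = gibbsMeasure N T` with `μ_T` away from the ends and uniqueness of the shift-invariant DLR state
(1-D transfer operator `e^{−U/2T}e^{−V(q′−q)/T}e^{−U/2T}`, momenta i.i.d. Gaussian), (ii) summable decay of
covariances UNIFORM in `N` with polynomial moments, (iii) `O(R)` boundary windows against `O(N)` bulk.
Leans on (tree): `InfiniteChainShiftInvariantUniqueness`, `InfiniteChainDLRUniqueness`, `ChainMixingClustering`,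
`InfiniteChainCovarianceMixingBox`, `InfiniteChainGibbsStationarity` (`E_{μ_T}𝒜g = 0`),
`EmbeddedDrudeMourre.AbelThermodynamicLimit` helpers `…CentralWindowEnsembleEquivalence`, `…AnchoredKuboUniformMixing`,
`integral_liouville_mul_gibbsDensity`; route support ShiftInvariantGibbsState (stmt-13420). Why it might fail:
N-UNIFORM exponential mixing of the free-end anharmonic Gibbs chain must cover the unbounded observables
`j`, `𝒜g` (cubic growth) and both boundary layers at once; any non-uniformity in `N` of the transfer-operator gap
near the free ends breaks the `o(N)`. [LandimOllaVaradhan2002 (doi:10.1214/aop/1023481000); Jara2006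
(doi:10.1214/009117906000000449); ArmstrongKuusiMourrat2019 Ch. 1–2 (`ν`, `ν*` subadditive quantities);
LanfordLebowitzLieb1977 §4; KomorowskiLandimOlla2012] -/
theorem stub_primalGluing :
  ∀ ω₂ lam β γ : ℝ, 0 < ω₂ → 0 < lam → 0 < β → 0 < γ → ∀ T : ℝ, 0 < T →
    ∀ μT : MeasureTheory.Measure ChainConfig, (pinnedChain ω₂ lam β γ).IsChainGibbsMeasure T μT → IsShiftInvariant μT →
      ∀ ν : ℝ, 0 < ν → ∀ g : ChainConfig → ℝ, IsLocalTestFunction g → ∀ ε : ℝ, 0 < ε → ∃ N₀ : ℕ, ∀ N : ℕ, N₀ ≤ N →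
        ∃ h : PhaseSpace N → ℝ, ContDiff ℝ ((⊤ : ℕ∞) : WithTop ℕ∞) h ∧ HasCompactSupport h ∧
          ((N:ℝ) - 1) * ((2 * (∑' x : ℤ, ((∫ σ, (pinnedChain ω₂ lam β γ).bondCurrentZ σ 0 * g (fun i => σ (i + x)) ∂μT) - (∫ σ, (pinnedChain ω₂ lam β γ).bondCurrentZ σ 0 ∂μT) * (∫ σ, g σ ∂μT)))
            - ν * (∑' x : ℤ, ((∫ σ, g σ * g (fun i => σ (i + x)) ∂μT) - (∫ σ, g σ ∂μT) * (∫ σ, g σ ∂μT)))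
            - ν⁻¹ * (∑' x : ℤ, ((∫ σ, liouvilleZ (pinnedChain ω₂ lam β γ) g σ * liouvilleZ (pinnedChain ω₂ lam β γ) g (fun i => σ (i + x)) ∂μT) - (∫ σ, liouvilleZ (pinnedChain ω₂ lam β γ) g σ ∂μT) * (∫ σ, liouvilleZ (pinnedChain ω₂ lam β γ) g σ ∂μT)))) - ε)
          ≤ 2 * (∫ z, (∑ i : Fin N, (pinnedChain ω₂ lam β γ).bondCurrent N i z) * h z ∂((pinnedChain ω₂ lam β γ).gibbsMeasure N T))
          - ν * (∫ z, h z ^ 2 ∂((pinnedChain ω₂ lam β γ).gibbsMeasure N T))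
          - γ * T * (∑ i : Fin N, ((if i.val = 0 then ∫ z, partialP i h z ^ 2 ∂((pinnedChain ω₂ lam β γ).gibbsMeasure N T) else 0)
            + (if i.val = N - 1 then ∫ z, partialP i h z ^ 2 ∂((pinnedChain ω₂ lam β γ).gibbsMeasure N T) else 0)))
          - ν⁻¹ * (∫ z, (∑ i : Fin N, (z.2 i * partialQ i h z - partialQ i ((pinnedChain ω₂ lam β γ).hamiltonian N) z * partialP i h z)) ^ 2 ∂((pinnedChain ω₂ lam β γ).gibbsMeasure N T)) := by
  sorry


/-- STUB 4 `stub_dualGluing` — STATIC GLUING OF THE DUAL WITNESS (size L; LOAD-BEARING with stub 3; statics only).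
For `P = pinnedChain ω₂ lam β γ` (all `> 0`), `T > 0`, every shift-invariant DLR Gibbs state `μ_T`, every `ν > 0`,
every local test function `u` and `ε > 0`: eventually in `N` there is `w ∈ C_c^∞(PhaseSpace N)` with
`ν⁻¹‖J + X_H w‖²_{μ_N} + ν‖w‖²_{μ_N} + γTΣ_{bath}‖∂_p w‖²_{μ_N} ≤ (N−1)(DUAL_ν(u) + ε)`.
Witness: the mollified, cut-off, centred sum of interior translates of `u` (as in stub 3); additionally
`‖J‖²_{μ_N} = Σ_{i,i'} Cov_{μ_N}(j_i, j_{i'}) = (N−1)⟨⟨j,j⟩⟩ + O(1)` over ALL `N−1` bonds including those in the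
two boundary layers (their covariance sums differ from the bulk value by a summable amount), and the cross term
`2⟨J, X_H w⟩_{μ_N} = 2(N−1)⟨⟨j, 𝒜u⟩⟩ + o(N)`. Leans on: as stub 3. Why it might fail: as stub 3, plus the
boundary bonds of `J` are not ours to drop — their `μ_N`-statistics must converge to the bulk ones summably in the
distance to the ends. [LandimOllaVaradhan2002; Jara2006; BernardinOlla2011 Prop. 4; ArmstrongKuusiMourrat2019;
LanfordLebowitzLieb1977 §4] -/
theorem stub_dualGluing :
  ∀ ω₂ lam β γ : ℝ, 0 < ω₂ → 0 < lam → 0 < β → 0 < γ → ∀ T : ℝ, 0 < T →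
    ∀ μT : MeasureTheory.Measure ChainConfig, (pinnedChain ω₂ lam β γ).IsChainGibbsMeasure T μT → IsShiftInvariant μT →
      ∀ ν : ℝ, 0 < ν → ∀ u : ChainConfig → ℝ, IsLocalTestFunction u → ∀ ε : ℝ, 0 < ε → ∃ N₀ : ℕ, ∀ N : ℕ, N₀ ≤ N →
        ∃ w : PhaseSpace N → ℝ, ContDiff ℝ ((⊤ : ℕ∞) : WithTop ℕ∞) w ∧ HasCompactSupport w ∧
          ν⁻¹ * (∫ z, ((∑ i : Fin N, (pinnedChain ω₂ lam β γ).bondCurrent N i z) + (∑ i : Fin N, (z.2 i * partialQ i w z - partialQ i ((pinnedChain ω₂ lam β γ).hamiltonian N) z * partialP i w z))) ^ 2 ∂((pinnedChain ω₂ lam β γ).gibbsMeasure N T))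
          + ν * (∫ z, w z ^ 2 ∂((pinnedChain ω₂ lam β γ).gibbsMeasure N T))
          + γ * T * (∑ i : Fin N, ((if i.val = 0 then ∫ z, partialP i w z ^ 2 ∂((pinnedChain ω₂ lam β γ).gibbsMeasure N T) else 0)
            + (if i.val = N - 1 then ∫ z, partialP i w z ^ 2 ∂((pinnedChain ω₂ lam β γ).gibbsMeasure N T) else 0)))
          ≤ ((N:ℝ) - 1) * ((ν⁻¹ * (∑' x : ℤ, ((∫ σ, ((pinnedChain ω₂ lam β γ).bondCurrentZ σ 0 + liouvilleZ (pinnedChain ω₂ lam β γ) u σ) * ((pinnedChain ω₂ lam β γ).bondCurrentZ (fun i => σ (i + x)) 0 + liouvilleZ (pinnedChain ω₂ lam β γ) u (fun i => σ (i + x))) ∂μT) - (∫ σ, ((pinnedChain ω₂ lam β γ).bondCurrentZ σ 0 + liouvilleZ (pinnedChain ω₂ lam β γ) u σ) ∂μT) * (∫ σ, ((pinnedChain ω₂ lam β γ).bondCurrentZ σ 0 + liouvilleZ (pinnedChain ω₂ lam β γ) u σ) ∂μT)))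
            + ν * (∑' x : ℤ, ((∫ σ, u σ * u (fun i => σ (i + x)) ∂μT) - (∫ σ, u σ ∂μT) * (∫ σ, u σ ∂μT)))) + ε) := by
  sorry


/-! ## §3 The composition -/

/-- COMPOSITION (kernel-checked, no sorry): the four stubs, BY NAME, give the crux
`Summit.AtomisticToContinuum.FouriersLaw.Theses.StaticAbelianSqueeze.ResolventSqueeze`.
Proof: beyond the two gluing thresholds, `(N−1)(PRIMAL_ν(g) − ε) ≤ Φ_N(h_N) ≤ F_N(ν) ≤ Ψ_N(w_N) ≤ (N−1)(DUAL_ν(u) + ε)`. -/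
theorem ResolventSqueeze_of :
    Sig.stub_fixedNPrimal → Sig.stub_fixedNDual → Sig.stub_primalGluing → Sig.stub_dualGluing →
      ResolventSqueeze := by
  intro hP hD hGP hGD ω₂ lam β γ hω hl hβ hγ T hT μT hGibbs hShift
  have hGP' := hGP ω₂ lam β γ hω hl hβ hγ T hT μT hGibbs hShift
  have hGD' := hGD ω₂ lam β γ hω hl hβ hγ T hT μT hGibbs hShift
  have hP' := hP ω₂ lam β γ hω hl hβ hγ T hT
  have hD' := hD ω₂ lam β γ hω hl hβ hγ T hT
  clear hP hD hGP hGD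
  -- the crux spells its brackets and functionals through `let`s; the stubs are `let`-free (zeta-expanded)
  dsimp only
  intro ν hν g u hg hu ε hε
  obtain ⟨N₁, hN₁⟩ := hGP' ν hν g hg ε hε
  obtain ⟨N₂, hN₂⟩ := hGD' ν hν u hu ε hε
  refine ⟨max N₁ N₂, fun N hN => ?_⟩
  obtain ⟨h, hhs, hhc, hlow⟩ := hN₁ N (le_trans (le_max_left _ _) hN)
  obtain ⟨w, hws, hwc, hupp⟩ := hN₂ N (le_trans (le_max_right _ _) hN)
  exact ⟨le_trans hlow (hP' ν hν N h hhs hhc), le_trans (hD' ν hν N w hws hwc) hupp⟩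

/-! ## §4 Instantiation through the sorried stubs (an `example`: registers nothing and leaves
`ResolventSqueeze_of` the unique declaration concluding the crux) -/

example : ResolventSqueeze :=
  ResolventSqueeze_of stub_fixedNPrimal stub_fixedNDual stub_primalGluing stub_dualGluing

end Summit.AtomisticToContinuum.FouriersLaw.Cruxes.ResolventSqueeze.Birth

end
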